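import Literature.NumberTheory.Automorphic.BCDTModularitySerreProofs
import Literature.NumberTheory.Automorphic.SerreConjectureProofs
import HarnessLib

/-!
# BCDT Theorem B (and Theorem A) from the Khare–Wintenberger theorem — assembly (proofs only)

Sibling *proofs* file (theorems only: no definition, no named fact, no instance) of
`Literature.NumberTheory.Automorphic.BCDTModularity` (named fact `BCDT.theoremB`,
Breuil–Conrad–Diamond–Taylor, J. Amer. Math. Soc. 14 (2001), Theorem B p. 843 = Thm. 2.2.1
p. 860: every continuous absolutely irreducible `ρ̄ : G_ℚ → GL₂(𝔽₅)` with cyclotomic determinant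
is modular).

It composes the two reductions already proved in the tree,

* `BCDT.theoremB_of_exists_newform_of_odd_irreducible` (file `BCDTModularitySerreProofs`):
  Theorem B follows from the weak form (3.2.3) of Serre's conjecture at `p = 5`
  (`exists_newform_of_odd_irreducible`, file `SerreConjecture`) — cyclotomic determinant ⇒ odd,
  absolutely irreducible ⇒ `ρ̄ ⊗ 𝔽̄₅` irreducible, weight `≥ 1` since `S₀ = 0`
  (BCDT, Introduction p. 845: "Serre has conjectured that all odd, irreducible `ρ̄` are strongly
  modular [Se2]");
* `exists_newform_of_odd_irreducible_of_khare_wintenberger` (file `SerreConjectureProofs`):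
  the weak form (3.2.3) follows from the strong form (3.2.4) = the named fact
  `khare_wintenberger p k` (Khare–Wintenberger, Invent. Math. 178 (2009), Thm. 1.2 and Thm. 9.1,
  with Kisin, Invent. Math. 178 (2009), Thm. 0.1 / Cor. 0.2 for Hypothesis (H)),

into the single statements `theoremB_of_khare_wintenberger` /
`theoremB_of_serreModularityConjecture`: **the whole mathematical debt of `BCDT.theoremB` along
this line is the one named fact `khare_wintenberger 5 k` (for `k : Type`, algebraically closed of
characteristic `5`, discrete)**, i.e. the discharge is
`theoremB_holds := theoremB_of_khare_wintenberger fun k _ _ _ => khare_wintenberger_holds 5 k`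
as soon as `khare_wintenberger_holds` (SIZE XL) exists — equivalently
`theoremB_of_exists_newform_of_odd_irreducible fun k _ _ _ => exists_newform_of_odd_irreducible_holds`.
The same composition is recorded for Theorem A (`exists_isNewformOf`, the Modularity Theorem)
with Conrad–Diamond–Taylor Thm. 7.2.4 (`exists_isNewformOf_of_khare_wintenberger_of_CDT`).

This is the "library" proof line of Theorem B (Serre's conjecture, now a theorem), as opposed to
the paper's own `3`–`5` switch (§2.2: an auxiliary elliptic curve `E` with `E[5] ≅ ρ̄` and
`ρ̄_{E,3}` surjective, Langlands–Tunnell at `3`, the lifting theorems 1.4.1–1.4.2 and CDT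
Thm. 7.2.1), which is assembled in `BCDTTheoremB.lean` from its own named inputs.

## References

* C. Breuil, B. Conrad, F. Diamond, R. Taylor, *On the modularity of elliptic curves over `ℚ`:
  wild 3-adic exercises*, J. Amer. Math. Soc. 14 (2001), 843–939, Theorem B (p. 843),
  Thm. 2.2.1–2.2.2 (p. 860), Introduction p. 845. [BCDTJAMS2001]
* C. Khare, J.-P. Wintenberger, *Serre's modularity conjecture (I)*, Invent. Math. 178 (2009),
  485–504, Thm. 1.2 and Thm. 9.1. [KhareWintenberger2009]
* M. Kisin, *Modularity of 2-adic Barsotti–Tate representations*, Invent. Math. 178 (2009),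
  587–634, Thm. 0.1, Cor. 0.2. [Kisin2009TwoAdic]
* J.-P. Serre, *Sur les représentations modulaires de degré 2 de `Gal(ℚ̄/ℚ)`*, Duke Math. J. 54
  (1987), §3.2, (3.2.3)–(3.2.4). [Serre1987]
-/

namespace Literature.NumberTheory.Automorphic.BCDT

open GaloisRepresentations EllipticCurves.ModularForms

/-- **BCDT Theorem B from Serre's conjecture in its strong form (3.2.4) at `p = 5`.**  If, for
every field `k : Type` with the discrete topology, Serre's strong conjecture
`SerreModularityConjecture 5 k` holds (its premises `[CharP k 5] [IsAlgClosed k]` are inside the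
proposition), then every continuous absolutely irreducible `ρ̄ : G_ℚ → GL₂(𝔽₅)` with cyclotomic
determinant is modular (`BCDT.theoremB`, BCDT 2001, Thm. B = Thm. 2.2.1): strong form ⇒ weak form
(3.2.3) (`exists_newform_of_odd_irreducible_of_serreModularityConjecture`) ⇒ Theorem B
(`theoremB_of_exists_newform_of_odd_irreducible`).
[cite: BCDTJAMS2001, Theorem B (= Thm. 2.2.1), Introduction p. 845]
[cite: Serre1987, §3.2, (3.2.3)–(3.2.4)] -/
theorem theoremB_of_serreModularityConjecture
    (hSerre : ∀ (k : Type) [Field k] [TopologicalSpace k] [DiscreteTopology k],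
      SerreModularityConjecture 5 k) :
    theoremB :=
  theoremB_of_exists_newform_of_odd_irreducible fun k _ _ _ =>
    exists_newform_of_odd_irreducible_of_serreModularityConjecture 5 k (hSerre k)

/-- **BCDT Theorem B from the Khare–Wintenberger theorem (as vendored).**  The named fact
`BCDT.theoremB` (Breuil–Conrad–Diamond–Taylor 2001, Thm. B = Thm. 2.2.1) follows from the named
fact `khare_wintenberger 5 k` (Khare–Wintenberger, Invent. Math. 178 (2009), Thm. 1.2 and
Thm. 9.1; for all discrete fields `k : Type`, the premises "`k` algebraically closed of
characteristic `5`" being inside the proposition).  Hence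
`theoremB_holds = theoremB_of_khare_wintenberger fun k _ _ _ => khare_wintenberger_holds 5 k`
once the (SIZE XL) discharge `khare_wintenberger_holds` exists; no other mathematics is owed by
Theorem B along this line.
[cite: BCDTJAMS2001, Theorem B (= Thm. 2.2.1), Introduction p. 845]
[cite: KhareWintenberger2009, Thm. 1.2 and Thm. 9.1] -/
theorem theoremB_of_khare_wintenberger
    (hKW : ∀ (k : Type) [Field k] [TopologicalSpace k] [DiscreteTopology k],
      khare_wintenberger 5 k) :
    theoremB :=
  theoremB_of_exists_newform_of_odd_irreducible fun k _ _ _ =>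
    exists_newform_of_odd_irreducible_of_khare_wintenberger 5 k (hKW k)

/-- **BCDT Theorem A (the Modularity Theorem, `exists_isNewformOf`) from the Khare–Wintenberger
theorem and Conrad–Diamond–Taylor Thm. 7.2.4.**  Trust base of this line:
{`khare_wintenberger 5 k` (`k : Type`), `CDT_theorem_7_2_4`}; Theorem B by
`theoremB_of_khare_wintenberger`, then BCDT Thm. 2.2.2 as assembled (Weil pairing proved) in
`exists_isNewformOf_of_theoremB_of_CDT`.
[cite: BCDTJAMS2001, Theorem A and Thm. 2.2.2]
[cite: KhareWintenberger2009, Thm. 1.2 and Thm. 9.1] -/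
theorem exists_isNewformOf_of_khare_wintenberger_of_CDT
    (hKW : ∀ (k : Type) [Field k] [TopologicalSpace k] [DiscreteTopology k],
      khare_wintenberger 5 k)
    (hCDT : CDT_theorem_7_2_4) : EllipticCurves.ModularForms.exists_isNewformOf :=
  exists_isNewformOf_of_theoremB_of_CDT (theoremB_of_khare_wintenberger hKW) hCDT

/-- **BCDT Theorem A from the Khare–Wintenberger theorem, CDT Thms. 7.1.2 and 7.2.2, and
Ogg–Saito for `V₅ E`** (CDT Thm. 7.2.4 replaced by its printed inputs, as in
`exists_isNewformOf_of_serre_of_CDT712_722`).  Trust base: {`khare_wintenberger 5 k`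
(`k : Type`), `CDT_theorem_7_1_2`, `CDT_theorem_7_2_2`,
`WeierstrassCurve.artinConductorExponent_tate_eq_conductorExponent_of_isElliptic · 5`}.
[cite: BCDTJAMS2001, Theorem A and Thm. 2.2.2]
[cite: KhareWintenberger2009, Thm. 1.2 and Thm. 9.1] -/
theorem exists_isNewformOf_of_khare_wintenberger_of_CDT712_722
    (hKW : ∀ (k : Type) [Field k] [TopologicalSpace k] [DiscreteTopology k],
      khare_wintenberger 5 k)
    (h712 : CDT_theorem_7_1_2) (h722 : CDT_theorem_7_2_2)
    (hOgg : ∀ W : WeierstrassCurve ℚ,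
      W.artinConductorExponent_tate_eq_conductorExponent_of_isElliptic 5) :
    EllipticCurves.ModularForms.exists_isNewformOf :=
  exists_isNewformOf_of_theoremB_of_CDT712_722 (theoremB_of_khare_wintenberger hKW) h712 h722 hOgg

end Literature.NumberTheory.Automorphic.BCDT
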